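import Summits.AtomisticToContinuum.HydrodynamicLimit.Theses.OneFlightGossipEngine
import Summits.AtomisticToContinuum.HydrodynamicLimit.Theorems.OneFlightGossipEngineKineticCurrentsWindowLDUniformMarginalEntropyLedgerPrelim
import Summits.AtomisticToContinuum.HydrodynamicLimit.Theorems.OneFlightGossipEngineKineticCurrentsWindowLDUniformOneBodyLedger
import Summits.AtomisticToContinuum.HydrodynamicLimit.Theorems.OneFlightGossipEngineKineticCurrentsWindowLDUniformFibreExpMoment
import Literature.Probability.Divergences.KLDivConvexity
import Literature.MathematicalPhysics.KineticTheory.HardSphereEulerProofs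
import Literature.MathematicalPhysics.KineticTheory.VelocityBlindPlacement
import HarnessLib

/-!
# The marginal entropy ledger
# (registered stub `stub_marginalEntropyLedger` of line `local-gibbs-entropy-ledger`,
# crux `KineticCurrentsWindowLDUniform`, stmt-AtomisticToContinuum-14662)

**Result (S3).** Let `λ = localGibbsMeasure σ a u₀ θ₀ N` be the local Gibbs law of `N + 1` hard
spheres (`0 < σ ≤ 1/2`, continuous profiles `a, θ₀ > 0`, `u₀`), a probability measure whose
velocity law GIVEN ALL POSITIONS is the heterogeneous product `⊗ᵢ N(u₀(xᵢ), θ₀(xᵢ) id)`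
(`lintegral_localGibbsMeasure`). For ANY probability law `P` of the `N + 1` spheres and its averaged
one-body marginal `f̄ = (N+1)⁻¹ ∑ᵢ P ∘ πᵢ⁻¹` on `𝕋³ × ℝ³`, the integrated fibre entropy against the
local Maxwellian field is paid by the `N`-body entropy:
`(N+1) ∫ KL(f̄(·|x) ‖ N(u₀(x), θ₀(x) id)) f̄.fst(dx) ≤ KL(P ‖ λ)` (fibres `f̄(·|x) = f̄.condKernel x`).

**Proof (Donsker–Varadhan duality).**
* `mel_sum_integral_le_toReal_klDiv` — for a bounded measurable one-body test function `g`
  normalised on every Maxwellian fibre, `∫ e^{g(x,·)} dN(u₀(x),θ₀(x)) = 1`, the many-body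
  observable `ψ(z) = ∑ᵢ g(zᵢ)` has `E_λ[e^ψ] = E_λ[∏ᵢ e^{g(zᵢ)}] ≤ 1` by the fibre structure of `λ`
  (`KineticCurrentsWindowLDUniformSketch.stub_fibreExpMoment`), so the Gibbs inequality
  `E_P[ψ] ≤ KL(P‖λ) + log E_λ[e^ψ]` (`integral_le_toReal_klDiv_add_log`) gives
  `∑ᵢ ∫ g(zᵢ) dP ≤ KL(P‖λ)`, i.e. `∫ g df̄ ≤ KL(P‖λ)/(N+1)`.
* The conditional Donsker–Varadhan bound with the Gaussian reference kernel
  `κ : x ↦ N(u₀(x), θ₀(x) id)` (`stub_marginalEntropyLedger_prelim`: kernel duality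
  `KL(f̄ ‖ f̄.fst ⊗ₘ κ) ≤ K`, then `∫ KL(f̄.condKernel x ‖ κ x) f̄.fst(dx) ≤ KL(f̄.fst ⊗ₘ f̄.condKernel ‖ f̄.fst ⊗ₘ κ)`
  through the kernel density `∂(f̄.condKernel)/∂κ`) converts this budget into the claim.
-/

noncomputable section

open MeasureTheory Set Filter InformationTheory ProbabilityTheory
open scoped ENNReal Topology

namespace Summit.AtomisticToContinuum.HydrodynamicLimit.Theorems.KineticCurrentsWindowLDUniformLocalGibbs

open Literature.Analysis.FluidPDE (HardSphereFlow Config localMaxwellian canonicalDensity liouville)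
open Literature.MathematicalPhysics.KineticTheory (T3 V3 hsDiameter localGibbsLaw localGibbsMeasure
  localGibbsProfile gaussMeasure isProbabilityMeasure_localGibbsMeasure continuous_localMaxwellian
  withDensity_localMaxwellian_eq_gaussMeasure)
open Summit.AtomisticToContinuum.HydrodynamicLimit.Theses.OneFlightGossipEngine
  (KineticCurrentsWindowLDUniform)
open Literature.MathematicalPhysics.KineticTheory.VelocityBlindPlacement (Flow)

/-! ### The many-body entropy inequality with fibrewise normalised test functions -/

/-- A one-body factor `e^{g(x,·)}` normalised under the Maxwellian `N(u, θ id)` has unit fibre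
integral against the local Maxwellian density: `∫⁻ e^{g(x,v)} M_{1,θ,u}(v) dv = 1`
(`M_{1,θ,u} dv = N(u, θ id)`, `withDensity_localMaxwellian_eq_gaussMeasure`). [folklore] -/
theorem mel_lintegral_exp_mul_localMaxwellian {g : T3 × V3 → ℝ} {C : ℝ} (hgm : Measurable g)
    (hgC : ∀ p, |g p| ≤ C) (x : T3) {u : V3} {θ : ℝ} (hθ : 0 < θ)
    (hg1 : ∫ v, Real.exp (g (x, v)) ∂gaussMeasure u θ = 1) :
    ∫⁻ v, ENNReal.ofReal (Real.exp (g (x, v))) * ENNReal.ofReal (localMaxwellian 1 θ u v) = 1 := by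
  have hM : Measurable fun w : V3 => ENNReal.ofReal (localMaxwellian 1 θ u w) :=
    (continuous_localMaxwellian 1 θ u).measurable.ennreal_ofReal
  have hGx : Measurable fun w : V3 => ENNReal.ofReal (Real.exp (g (x, w))) :=
    (Real.measurable_exp.comp (hgm.comp measurable_prodMk_left)).ennreal_ofReal
  have hint : Integrable (fun v : V3 => Real.exp (g (x, v))) (gaussMeasure u θ) :=
    Integrable.of_bound (Real.measurable_exp.comp
      (hgm.comp measurable_prodMk_left)).aestronglyMeasurable (Real.exp C)
      (ae_of_all _ fun v => by
        rw [Real.norm_eq_abs, abs_of_pos (Real.exp_pos _)]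
        exact Real.exp_le_exp.2 ((le_abs_self _).trans (hgC (x, v))))
  calc ∫⁻ v, ENNReal.ofReal (Real.exp (g (x, v))) * ENNReal.ofReal (localMaxwellian 1 θ u v)
      = ∫⁻ v, ((fun w : V3 => ENNReal.ofReal (localMaxwellian 1 θ u w)) *
          fun w : V3 => ENNReal.ofReal (Real.exp (g (x, w)))) v :=
        lintegral_congr fun v => mul_comm _ _
    _ = ∫⁻ v, ENNReal.ofReal (Real.exp (g (x, v))) ∂gaussMeasure u θ := by
        rw [← withDensity_localMaxwellian_eq_gaussMeasure hθ u,
          lintegral_withDensity_eq_lintegral_mul _ hM hGx]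
    _ = ENNReal.ofReal (∫ v, Real.exp (g (x, v)) ∂gaussMeasure u θ) :=
        (ofReal_integral_eq_lintegral_ofReal hint (ae_of_all _ fun v => (Real.exp_pos _).le)).symm
    _ = 1 := by rw [hg1, ENNReal.ofReal_one]

/-- **The many-body entropy inequality.** For the local Gibbs measure `λ` (`σ ≤ 1/2`), a
probability law `P` with `KL(P‖λ) < ∞`, and a bounded measurable one-body test function `g`
normalised on every Maxwellian fibre (`∫ e^{g(x,·)} dN(u₀(x), θ₀(x) id) = 1` for all `x`):
`∑ᵢ ∫ g(zᵢ) P(dz) ≤ KL(P‖λ)`. Gibbs inequality `E_P[ψ] ≤ KL(P‖λ) + log E_λ[e^ψ]` for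
`ψ = ∑ᵢ g ∘ πᵢ`, and `E_λ[e^ψ] = E_λ[∏ᵢ e^{g(zᵢ)}] ≤ 1` because given the positions the velocities
of `λ` are independent local Maxwellians (`stub_fibreExpMoment`). [folklore] -/
theorem mel_sum_integral_le_toReal_klDiv {a θ₀ : T3 → ℝ} {u₀ : T3 → V3} (ha : Continuous a)
    (hθ : Continuous θ₀) (hu : Continuous u₀) (ha0 : ∀ x, 0 < a x) (hθ0 : ∀ x, 0 < θ₀ x) {σ : ℝ}
    (hσ : 0 < σ) (hσ2 : σ ≤ 1 / 2) (N : ℕ) (P : Measure (Config (N + 1) (Fin 3) T3))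
    [IsProbabilityMeasure P] (hfin : klDiv P (localGibbsMeasure σ a u₀ θ₀ N) ≠ ⊤)
    {g : T3 × V3 → ℝ} {C : ℝ} (hgm : Measurable g) (hgC : ∀ p, |g p| ≤ C)
    (hg1 : ∀ x, ∫ v, Real.exp (g (x, v)) ∂gaussMeasure (u₀ x) (θ₀ x) = 1) :
    ∑ i : Fin (N + 1), ∫ z, g (z i) ∂P ≤ (klDiv P (localGibbsMeasure σ a u₀ θ₀ N)).toReal := by
  haveI := isProbabilityMeasure_localGibbsMeasure ha hθ hu ha0 hθ0 hσ2 N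
  -- the many-body observable `ψ = ∑ᵢ g ∘ πᵢ`
  have hgi : ∀ i : Fin (N + 1), Measurable fun z : Config (N + 1) (Fin 3) T3 => g (z i) :=
    fun i => hgm.comp (measurable_pi_apply i)
  have hψm : Measurable fun z : Config (N + 1) (Fin 3) T3 => ∑ i, g (z i) :=
    Finset.measurable_sum _ fun i _ => hgi i
  have hC0 : 0 ≤ C := (abs_nonneg _).trans (hgC ((0 : T3), (0 : V3)))
  have hψb : ∀ z : Config (N + 1) (Fin 3) T3, |∑ i, g (z i)| ≤ ((N : ℝ) + 1) * C := fun z => by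
    calc |∑ i, g (z i)| ≤ ∑ i, |g (z i)| := Finset.abs_sum_le_sum_abs _ _
      _ ≤ ∑ _i : Fin (N + 1), C := Finset.sum_le_sum fun i _ => hgC (z i)
      _ = ((N : ℝ) + 1) * C := by
          rw [Finset.sum_const, Finset.card_univ, Fintype.card_fin, nsmul_eq_mul]
          push_cast
          ring
  -- Gibbs / Donsker–Varadhan inequality
  have hDV := Literature.Probability.Divergences.integral_le_toReal_klDiv_add_log hfin hψm hψb
  have hsum : ∫ z, ∑ i, g (z i) ∂P = ∑ i, ∫ z, g (z i) ∂P :=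
    integral_finsetSum _ fun i _ => Integrable.of_bound (hgi i).aestronglyMeasurable C
      (ae_of_all _ fun z => by rw [Real.norm_eq_abs]; exact hgC (z i))
  -- the exponential moment `E_λ[e^ψ] ≤ 1`
  have hGm : Measurable fun y : T3 × V3 => ENNReal.ofReal (Real.exp (g y)) :=
    (Real.measurable_exp.comp hgm).ennreal_ofReal
  have hfib := KineticCurrentsWindowLDUniformSketch.stub_fibreExpMoment a θ₀ u₀ ha hθ hu ha0 hθ0 σ
    hσ hσ2 N (fun y => ENNReal.ofReal (Real.exp (g y))) hGm 1
    (fun x => (mel_lintegral_exp_mul_localMaxwellian hgm hgC x (hθ0 x) (hg1 x)).le)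
  rw [one_pow] at hfib
  have hexp_eq : ∀ z : Config (N + 1) (Fin 3) T3,
      ENNReal.ofReal (Real.exp (∑ i, g (z i))) = ∏ i, ENNReal.ofReal (Real.exp (g (z i))) := by
    intro z
    rw [Real.exp_sum, ENNReal.ofReal_prod_of_nonneg fun i _ => (Real.exp_pos _).le]
  have hmom : ∫ z, Real.exp (∑ i, g (z i)) ∂localGibbsMeasure σ a u₀ θ₀ N ≤ 1 := by
    rw [integral_eq_lintegral_of_nonneg_ae (ae_of_all _ fun z => (Real.exp_pos _).le)
      (Real.measurable_exp.comp hψm).aestronglyMeasurable]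
    simp_rw [hexp_eq]
    exact ENNReal.toReal_le_of_le_ofReal zero_le_one (by rwa [ENNReal.ofReal_one])
  have hlog : Real.log (∫ z, Real.exp (∑ i, g (z i)) ∂localGibbsMeasure σ a u₀ θ₀ N) ≤ 0 :=
    Real.log_nonpos (integral_nonneg fun z => (Real.exp_pos _).le) hmom
  rw [← hsum]
  linarith

/-! ### The marginal entropy ledger -/

/-- S3 — THE MARGINAL ENTROPY LEDGER (static measure theory, M/L). For the local Gibbs measure `λ^N`
(`σ ≤ 1/2`: a probability measure whose velocity fibre GIVEN THE POSITIONS is the heterogeneous product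
`⊗ᵢ N(u₀(xᵢ), θ₀(xᵢ)I)`, tree `lintegral_localGibbsMeasure` / `velMeasure`) and ANY probability law `P` of
`N+1` spheres, the fibre entropy of the averaged one-body marginal `f̄ = (N+1)⁻¹ Σᵢ P∘πᵢ⁻¹` against the
local Maxwellian field is at most `KL(P ‖ λ^N)/(N+1)`. Proof by Donsker–Varadhan duality: for every
bounded measurable `g` normalised on the Maxwellian fibres, `(N+1) ∫ g df̄ = E_P[∑ᵢ g∘πᵢ] ≤ KL(P‖λ^N)`
(Gibbs inequality plus `E_λ[∏ᵢ e^{g(zᵢ)}] ≤ 1` from the fibre structure of `λ^N`,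
`mel_sum_integral_le_toReal_klDiv`); the conditional Donsker–Varadhan bound with the Gaussian reference
kernel `x ↦ N(u₀(x), θ₀(x)I)` and the conditional chain-rule inequality for `f̄ = f̄.fst ⊗ f̄.condKernel`
(`stub_marginalEntropyLedger_prelim`) turn this budget into the integrated fibre entropy bound. No
dynamics, no `σ`-expansion. -/
theorem stub_marginalEntropyLedger :
    ∀ (a θ₀ : T3 → ℝ) (u₀ : T3 → V3), Continuous a → Continuous θ₀ → Continuous u₀ →
      (∀ x, 0 < a x) → (∀ x, 0 < θ₀ x) → ∀ σ : ℝ, 0 < σ → σ ≤ 1 / 2 → ∀ N : ℕ,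
      ∀ (P : Measure (Config (N + 1) (Fin 3) T3)) [IsProbabilityMeasure P],
      ∀ (fbar : Measure (T3 × V3)) [IsProbabilityMeasure fbar],
        fbar = ((N : ℝ≥0∞) + 1)⁻¹ • ∑ i : Fin (N + 1), P.map (fun z => z i) →
        ((N : ℝ≥0∞) + 1) * ∫⁻ x, klDiv (fbar.condKernel x) (gaussMeasure (u₀ x) (θ₀ x)) ∂fbar.fst ≤
          klDiv P (localGibbsMeasure σ a u₀ θ₀ N) := by
  intro a θ₀ u₀ ha hθ hu ha0 hθ0 σ hσ hσ2 N P _ fbar _ hfbar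
  by_cases hfin : klDiv P (localGibbsMeasure σ a u₀ θ₀ N) = ⊤
  · rw [hfin]
    exact le_top
  -- the Gaussian reference kernel `κ x = N(u₀(x), θ₀(x) id)`
  let κ : Kernel T3 V3 :=
    ⟨fun x => gaussMeasure (u₀ x) (θ₀ x), obl_measurable_gaussMeasure hθ.measurable hu.measurable⟩
  haveI : IsMarkovKernel κ :=
    ⟨fun x => show IsProbabilityMeasure (gaussMeasure (u₀ x) (θ₀ x)) from inferInstance⟩
  have hN : (0 : ℝ) < (N : ℝ) + 1 := by positivity
  -- the Donsker–Varadhan budget of `f̄` against `κ`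
  have hbudget : ∀ (g : T3 × V3 → ℝ) (C : ℝ), Measurable g → (∀ p, |g p| ≤ C) →
      (∀ x, ∫ v, Real.exp (g (x, v)) ∂(κ x) = 1) →
      ∫ p, g p ∂fbar ≤ (klDiv P (localGibbsMeasure σ a u₀ θ₀ N)).toReal / ((N : ℝ) + 1) := by
    intro g C hgm hgC hg1
    have hsum := mel_sum_integral_le_toReal_klDiv ha hθ hu ha0 hθ0 hσ hσ2 N P hfin hgm hgC hg1
    have hgi : ∀ i : Fin (N + 1), Integrable g (P.map fun z => z i) := fun i =>
      Integrable.of_bound hgm.aestronglyMeasurable C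
        (ae_of_all _ fun p => by rw [Real.norm_eq_abs]; exact hgC p)
    have hmap : ∀ i : Fin (N + 1), ∫ p, g p ∂(P.map fun z => z i) = ∫ z, g (z i) ∂P := fun i =>
      integral_map (measurable_pi_apply i).aemeasurable hgm.aestronglyMeasurable
    have htoReal : (((N : ℝ≥0∞) + 1)⁻¹).toReal = ((N : ℝ) + 1)⁻¹ := by
      rw [ENNReal.toReal_inv, ENNReal.toReal_add (ENNReal.natCast_ne_top N) ENNReal.one_ne_top,
        ENNReal.toReal_natCast, ENNReal.toReal_one]
    rw [hfbar, integral_smul_measure, integral_finsetSum_measure fun i _ => hgi i, htoReal,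
      smul_eq_mul, div_eq_inv_mul]
    simp_rw [hmap]
    exact mul_le_mul_of_nonneg_left hsum (inv_nonneg.2 hN.le)
  have h1 := stub_marginalEntropyLedger_prelim fbar κ _ hbudget
  have hofReal : ENNReal.ofReal ((N : ℝ) + 1) = (N : ℝ≥0∞) + 1 := by
    rw [ENNReal.ofReal_add N.cast_nonneg zero_le_one, ENNReal.ofReal_natCast, ENNReal.ofReal_one]
  calc ((N : ℝ≥0∞) + 1) * ∫⁻ x, klDiv (fbar.condKernel x) (gaussMeasure (u₀ x) (θ₀ x)) ∂fbar.fst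
      = ((N : ℝ≥0∞) + 1) * ∫⁻ x, klDiv (fbar.condKernel x) (κ x) ∂fbar.fst := rfl
    _ ≤ ((N : ℝ≥0∞) + 1) *
          ENNReal.ofReal ((klDiv P (localGibbsMeasure σ a u₀ θ₀ N)).toReal / ((N : ℝ) + 1)) :=
        mul_le_mul_right h1 _
    _ = klDiv P (localGibbsMeasure σ a u₀ θ₀ N) := by
        rw [ENNReal.ofReal_div_of_pos hN, ENNReal.ofReal_toReal hfin, hofReal,
          ENNReal.mul_div_cancel (by positivity) (ENNReal.add_ne_top.2
            ⟨ENNReal.natCast_ne_top N, ENNReal.one_ne_top⟩)]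

end Summit.AtomisticToContinuum.HydrodynamicLimit.Theorems.KineticCurrentsWindowLDUniformLocalGibbs

end
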